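import Summits.ValiantsHypothesis.ValiantsHypothesis.Theorems.LacunarySymmetroidMatrixDescartesDoorA26WallBubblingConfluentFrame
import Summits.ValiantsHypothesis.ValiantsHypothesis.Theorems.LacunarySymmetroidMatrixDescartesDoorA26WallBubblingBubblingNormalisation
import Summits.ValiantsHypothesis.ValiantsHypothesis.Theorems.LacunarySymmetroidMatrixDescartesDoorA26WallBubblingConfluentCount

/-!
# Wall bubbling for `DoorA26` — (W) chain piece: THE CONFLUENT DETERMINANT AS A QUADRATIC FORM IN THE FRAME, AND ITS NON-DEGENERACY AT A GENERIC FACE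

HONEST FRAMING.  Chain lemmas for obligation (W) `stub_weylFaces` of `Cruxes/DoorA26/Lines/wall_bubbling.lean` (stmt-ValiantsHypothesis-19979
`DoorA26`; OPEN, typed, never asserted), W2 seat val-sym-door-p1 g14; statement file `Cruxes/DoorA26/Lines/wall_bubbling_ConfluentDoor.lean` rev 3
(`confluentDet`, `ConfluentDoor26`, `IsGenericWeylFace`).  Positions: the Weyl pair at `0, 5`, the four other letters at `k.succ.castSucc`.

* `confluentDet_eq_quadForm` — the door's confluent determinant `det(e^{δ₀t}(W₀ + t·W₅) + Σ_k e^{δ_{k+1}t} W_{k+1})` IS the quadratic form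
  `Σ_pq polar(W_p, W_q)·c_p(t)c_q(t)` in the limit coefficient functions `c_l = e^{δ_l t}` (`l ≤ 4`), `c₅ = dslope (y ↦ e^{yt}) δ₀ δ₀ = t e^{δ₀t}`
  (`det_sum_smul_fin_two`, p618712);
* `slot_inj` — slot bookkeeping at a GENERIC face: if `δ0 ∘ castSucc` is 2-Sidon (the 15 pair sums pairwise distinct, = `IsGenericWeylFace`) and
  `δ0 5 = δ0 0`, two ordered pairs of positions with equal exponent sum and equal number of confluent positions agree up to order (`decide` on `Fin 6`);
* **`confluentDet_ne_zero_of_polar_ne_zero`** — NON-DEGENERACY: at a generic face, a frame `W` with ONE non-zero polar Gram entry has a confluent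
  determinant that is not identically zero — slot independence via the Laguerre–Pólya count `extSum_card_zeros_le` (W4 #1 p646545) and the slot
  bookkeeping `confluentDet_slots_le` / `card_pairSums_five` (W1 #12 p657763): 21 prescribed zeros would exceed the count.  This DISCHARGES the line's
  named guard `stub_weylFaces_generic_nondegLimit` for the GRAM normalisation (with letter normalisation it can fail; with Gram normalisation it cannot).

No new definitions; nothing here bears on `DoorA26`, `MatrixDescartes` (stmt-ValiantsHypothesis-18050) or `VP ≠ VNP`.

[folklore] linear independence of `t^d e^{wt}`; [this work] the slot bookkeeping of the confluent frame.
-/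

-- `Summit.ValiantsHypothesis.ValiantsHypothesis.…` repeats a component by the D-0017 layout
-- (single-conjunct summit), which the `dupNamespace` linter flags; the name is mandated.
set_option linter.dupNamespace false

namespace Summit.ValiantsHypothesis.ValiantsHypothesis.Theorems.LacunarySymmetroidMatrixDescartes.WallBubbling

open Finset Filter Topology Polynomial
open Bubbling (polar polar_comm polar_self det_sum_smul_fin_two extSum_card_zeros_le confluentDet_slots_le card_pairSums_five)
open scoped BigOperators

/-! ## 1. Positions and the confluent determinant as a quadratic form -/

/-- Splitting a sum over `Fin 6` into the positions `0`, `1..4` (as `k.succ.castSucc`, `k : Fin 4`) and `5`. [folklore] -/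
theorem sum_fin_six_split {M : Type*} [AddCommMonoid M] (f : Fin 6 → M) :
    ∑ l, f l = f 0 + ∑ k : Fin 4, f k.succ.castSucc + f 5 := by
  rw [Fin.sum_univ_castSucc, Fin.sum_univ_succ]
  rfl

/-- The middle positions are neither `0` nor `5`. [folklore] -/
theorem succ_castSucc_ne (k : Fin 4) : (k.succ.castSucc : Fin 6) ≠ 0 ∧ (k.succ.castSucc : Fin 6) ≠ 5 := by
  constructor
  · exact Fin.castSucc_ne_zero_iff.mpr (Fin.succ_ne_zero k)
  · exact Fin.ne_of_lt (Fin.castSucc_lt_last k.succ)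

/-- **The confluent determinant of the door as the same quadratic form** at the limit coefficient functions (`c₅ = dslope … δ₀ δ₀ = t e^{δ₀t}`):
for `W : Fin 6 → Sym₂(ℝ)` (`τ = W₀`, `T = W₅`, `S_k = W_{k+1}`). [this work] -/
theorem confluentDet_eq_quadForm (δ0 : Fin 6 → ℝ) (W : Fin 6 → Matrix (Fin 2) (Fin 2) ℝ) (t : ℝ) :
    ((Real.exp (δ0 0 * t)) • (W 0 + t • W 5) + ∑ k : Fin 4, (Real.exp (δ0 k.succ.castSucc * t)) • W k.succ.castSucc).det
      = ∑ p, ∑ q, polar (W p) (W q) *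
          ((if p = 5 then dslope (fun y : ℝ => Real.exp (y * t)) (δ0 0) (δ0 0) else Real.exp (δ0 p * t)) *
            (if q = 5 then dslope (fun y : ℝ => Real.exp (y * t)) (δ0 0) (δ0 0) else Real.exp (δ0 q * t))) := by
  have hsum : (Real.exp (δ0 0 * t)) • (W 0 + t • W 5) + ∑ k : Fin 4, (Real.exp (δ0 k.succ.castSucc * t)) • W k.succ.castSucc
      = ∑ l, (if l = 5 then dslope (fun y : ℝ => Real.exp (y * t)) (δ0 0) (δ0 0) else Real.exp (δ0 l * t)) • W l := by
    rw [sum_fin_six_split]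
    have hmid : ∀ k : Fin 4,
        (if (k.succ.castSucc : Fin 6) = 5 then dslope (fun y : ℝ => Real.exp (y * t)) (δ0 0) (δ0 0) else Real.exp (δ0 k.succ.castSucc * t))
          • W k.succ.castSucc = Real.exp (δ0 k.succ.castSucc * t) • W k.succ.castSucc := by
      intro k; rw [if_neg (succ_castSucc_ne k).2]
    simp only [hmid]
    have h05 : ((0 : Fin 6) = 5) = False := by simp
    simp only [h05, if_true, if_false, dslope_exp_same, smul_add, smul_smul]
    rw [mul_comm (Real.exp (δ0 0 * t)) t]
    abel
  rw [hsum, det_sum_smul_fin_two]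
  refine Finset.sum_congr rfl fun p _ => Finset.sum_congr rfl fun q _ => ?_
  ring

/-! ## 2. Non-degeneracy at a generic face (slot independence) -/

/-- Slot bookkeeping at a generic Weyl face: with 2-Sidon exponents `e` on `Fin 5`, extended to `Fin 6` by `δ0 5 = δ0 0`, two ordered pairs of
frame positions with the same exponent sum and the same number of confluent positions (`= 5`) are equal up to order. [this work] -/
theorem slot_inj (δ0 : Fin 6 → ℝ) (h05 : δ0 5 = δ0 0)
    (hsid : ∀ a b c d : Fin 5, δ0 a.castSucc + δ0 b.castSucc = δ0 c.castSucc + δ0 d.castSucc → (a = c ∧ b = d) ∨ (a = d ∧ b = c))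
    (p q p' q' : Fin 6) (hval : δ0 p' + δ0 q' = δ0 p + δ0 q)
    (hdeg : (if p' = 5 then 1 else 0) + (if q' = 5 then 1 else 0) = ((if p = 5 then 1 else 0) + (if q = 5 then 1 else 0) : ℕ)) :
    (p' = p ∧ q' = q) ∨ (p' = q ∧ q' = p) := by
  -- reduction map `Fin 6 → Fin 5`, `5 ↦ 0`
  have hρ : ∀ l : Fin 6, δ0 l = δ0 (Fin.castSucc ⟨(l : ℕ) % 5, Nat.mod_lt _ (by norm_num)⟩) := by
    intro l
    fin_cases l
    · rfl
    · rfl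
    · rfl
    · rfl
    · rfl
    · exact h05
  rw [hρ p, hρ q, hρ p', hρ q'] at hval
  have key := hsid _ _ _ _ hval
  clear hval hρ hsid h05
  revert p q p' q'
  decide

/-- **NON-DEGENERACY OF THE CONFLUENT LIMIT AT A GENERIC FACE.**  If the exponents are 2-Sidon (generic Weyl face) and some polar Gram entry of the
limit frame `W` is non-zero, the confluent determinant `det(e^{δ₀t}(W₀ + tW₅) + Σ_k e^{δ_{k+1}t}W_{k+1})` is not identically zero. [this work] -/
theorem confluentDet_ne_zero_of_polar_ne_zero (δ0 : Fin 6 → ℝ) (h05 : δ0 5 = δ0 0)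
    (hsid : ∀ a b c d : Fin 5, δ0 a.castSucc + δ0 b.castSucc = δ0 c.castSucc + δ0 d.castSucc → (a = c ∧ b = d) ∨ (a = d ∧ b = c))
    (W : Fin 6 → Matrix (Fin 2) (Fin 2) ℝ) (hW : ∃ p q, polar (W p) (W q) ≠ 0) :
    ∃ t, ((Real.exp (δ0 0 * t)) • (W 0 + t • W 5) + ∑ k : Fin 4, (Real.exp (δ0 k.succ.castSucc * t)) • W k.succ.castSucc).det ≠ 0 := by
  classical
  by_contra hall
  push Not at hall
  obtain ⟨p₀, q₀, hpq₀⟩ := hW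
  -- the five exponents and their pair sums
  set e : Fin 5 → ℝ := fun m => δ0 m.castSucc with he
  set F : Finset ℝ := (univ : Finset (Fin 5 × Fin 5)).image (fun pr => e pr.1 + e pr.2) with hF
  -- reduction of a frame position to a letter, and the value of a position
  have hρ : ∀ l : Fin 6, δ0 l = e ⟨(l : ℕ) % 5, Nat.mod_lt _ (by norm_num)⟩ := by
    intro l
    fin_cases l
    · rfl
    · rfl
    · rfl
    · rfl
    · rfl
    · exact h05
  have hmemF : ∀ p q : Fin 6, δ0 p + δ0 q ∈ F := by
    intro p q
    rw [hF, Finset.mem_image]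
    exact ⟨(⟨(p : ℕ) % 5, Nat.mod_lt _ (by norm_num)⟩, ⟨(q : ℕ) % 5, Nat.mod_lt _ (by norm_num)⟩), Finset.mem_univ _,
      by rw [hρ p, hρ q]⟩
  -- the slot polynomials
  set P : ℝ → ℝ[X] := fun w => ∑ p : Fin 6, ∑ q : Fin 6,
    if δ0 p + δ0 q = w then C (polar (W p) (W q)) * X ^ ((if p = 5 then 1 else 0) + (if q = 5 then 1 else 0)) else 0 with hP
  -- (a) the extended sum is the confluent determinant, hence vanishes identically
  have hrep : ∀ t : ℝ, ∑ w ∈ F, (P w).eval t * Real.exp (w * t) = 0 := by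
    intro t
    have hlim := hall t
    rw [confluentDet_eq_quadForm] at hlim
    rw [← hlim]
    have h1 : ∀ w ∈ F, (P w).eval t * Real.exp (w * t)
        = ∑ p : Fin 6, ∑ q : Fin 6, if δ0 p + δ0 q = w then
            polar (W p) (W q) * t ^ ((if p = 5 then 1 else 0) + (if q = 5 then 1 else 0)) * Real.exp (w * t) else 0 := by
      intro w _
      rw [hP]
      simp only [eval_finsetSum, Finset.sum_mul]
      refine Finset.sum_congr rfl fun p _ => Finset.sum_congr rfl fun q _ => ?_
      by_cases hv : δ0 p + δ0 q = w
      · rw [if_pos hv, if_pos hv, eval_mul, eval_C, eval_pow, eval_X]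
      · rw [if_neg hv, if_neg hv, eval_zero, zero_mul]
    rw [Finset.sum_congr rfl h1, Finset.sum_comm]
    refine Finset.sum_congr rfl fun p _ => ?_
    rw [Finset.sum_comm]
    refine Finset.sum_congr rfl fun q _ => ?_
    rw [Finset.sum_ite_eq F (δ0 p + δ0 q), if_pos (hmemF p q)]
    -- the slot function of the pair `(p,q)`
    by_cases hp : p = 5 <;> by_cases hq : q = 5
    · subst hp; subst hq
      simp only [if_true, dslope_exp_same, h05]
      rw [show (δ0 0 + δ0 0) * t = δ0 0 * t + δ0 0 * t by ring, Real.exp_add]; ring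
    · subst hp
      simp only [if_true, if_neg hq, dslope_exp_same, h05]
      rw [show (δ0 0 + δ0 q) * t = δ0 0 * t + δ0 q * t by ring, Real.exp_add]; ring
    · subst hq
      simp only [if_true, if_neg hp, dslope_exp_same, h05]
      rw [show (δ0 p + δ0 0) * t = δ0 p * t + δ0 0 * t by ring, Real.exp_add]; ring
    · simp only [if_neg hp, if_neg hq]
      rw [show (δ0 p + δ0 q) * t = δ0 p * t + δ0 q * t by ring, Real.exp_add]; ring
  -- (b) degree bounds of the slot polynomials
  have he0 : e 0 = δ0 0 := by show δ0 (Fin.castSucc 0) = δ0 0; rw [Fin.castSucc_zero]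
  have hes : ∀ k : Fin 4, e k.succ = δ0 k.succ.castSucc := fun k => rfl
  have hdegP : ∀ w, (P w).natDegree ≤ (if w = e 0 + e 0 then 2 else 0) +
      (if w ∈ (univ : Finset (Fin 4)).image (fun k => e 0 + e k.succ) then 1 else 0) := by
    intro w
    rw [hP]
    refine natDegree_sum_le_of_forall_le _ _ fun p _ => natDegree_sum_le_of_forall_le _ _ fun q _ => ?_
    by_cases hv : δ0 p + δ0 q = w
    · rw [if_pos hv]
      refine (natDegree_C_mul_X_pow_le _ _).trans ?_
      by_cases hp : p = 5 <;> by_cases hq : q = 5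
      · have hw : w = e 0 + e 0 := by rw [← hv, hp, hq, h05, he0]
        rw [if_pos hp, if_pos hq, if_pos hw]; exact Nat.le_add_right _ _
      · rw [if_pos hp, if_neg hq]
        rcases Fin.eq_castSucc_or_eq_last q with ⟨m, rfl⟩ | hq5
        · rcases Fin.eq_zero_or_eq_succ m with rfl | ⟨k, rfl⟩
          · have hw : w = e 0 + e 0 := by rw [← hv, hp, h05, he0, Fin.castSucc_zero]
            rw [if_pos hw]; exact le_trans (by norm_num) (Nat.le_add_right _ _)
          · have hw : w ∈ (univ : Finset (Fin 4)).image (fun k => e 0 + e k.succ) :=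
              Finset.mem_image.mpr ⟨k, Finset.mem_univ _, by rw [← hv, hp, h05, he0, hes]⟩
            rw [if_pos hw]; exact le_trans (by norm_num) (Nat.le_add_left _ _)
        · exact absurd hq5 hq
      · rw [if_neg hp, if_pos hq]
        rcases Fin.eq_castSucc_or_eq_last p with ⟨m, rfl⟩ | hp5
        · rcases Fin.eq_zero_or_eq_succ m with rfl | ⟨k, rfl⟩
          · have hw : w = e 0 + e 0 := by rw [← hv, hq, h05, he0, Fin.castSucc_zero]
            rw [if_pos hw]; exact le_trans (by norm_num) (Nat.le_add_right _ _)
          · have hw : w ∈ (univ : Finset (Fin 4)).image (fun k => e 0 + e k.succ) :=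
              Finset.mem_image.mpr ⟨k, Finset.mem_univ _, by rw [← hv, hq, h05, he0, hes, add_comm]⟩
            rw [if_pos hw]; exact le_trans (by norm_num) (Nat.le_add_left _ _)
        · exact absurd hp5 hp
      · rw [if_neg hp, if_neg hq]; exact Nat.zero_le _
    · rw [if_neg hv, natDegree_zero]; exact Nat.zero_le _
  -- (c) an active slot: the coefficient of the slot of `(p₀,q₀)` is `polar(W p₀, W q₀)` or twice it
  have hact : ∃ w ∈ F, P w ≠ 0 := by
    refine ⟨δ0 p₀ + δ0 q₀, hmemF p₀ q₀, fun hzero => ?_⟩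
    set d₀ : ℕ := (if p₀ = 5 then 1 else 0) + (if q₀ = 5 then 1 else 0) with hd₀
    have hcoeff : (P (δ0 p₀ + δ0 q₀)).coeff d₀
        = ∑ p : Fin 6, ∑ q : Fin 6, if (p = p₀ ∧ q = q₀) ∨ (p = q₀ ∧ q = p₀) then polar (W p) (W q) else 0 := by
      rw [hP]
      simp only [finsetSum_coeff]
      refine Finset.sum_congr rfl fun p _ => Finset.sum_congr rfl fun q _ => ?_
      by_cases hv : δ0 p + δ0 q = δ0 p₀ + δ0 q₀
      · rw [if_pos hv, coeff_C_mul_X_pow]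
        by_cases hd : d₀ = (if p = 5 then 1 else 0) + (if q = 5 then 1 else 0)
        · rw [if_pos hd, if_pos (slot_inj δ0 h05 hsid p₀ q₀ p q hv (by rw [← hd]))]
        · rw [if_neg hd, if_neg]
          rintro (⟨rfl, rfl⟩ | ⟨rfl, rfl⟩)
          · exact hd rfl
          · exact hd (by rw [hd₀]; ring)
      · rw [if_neg hv, coeff_zero, if_neg]
        rintro (⟨rfl, rfl⟩ | ⟨rfl, rfl⟩)
        · exact hv rfl
        · exact hv (add_comm _ _)
    have hval : (P (δ0 p₀ + δ0 q₀)).coeff d₀ = if p₀ = q₀ then polar (W p₀) (W q₀) else 2 * polar (W p₀) (W q₀) := by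
      rw [hcoeff]
      by_cases hpq : p₀ = q₀
      · subst hpq
        rw [if_pos rfl]
        have : ∀ p q : Fin 6, ((p = p₀ ∧ q = p₀) ∨ (p = p₀ ∧ q = p₀)) ↔ (p = p₀ ∧ q = p₀) := fun p q => or_self_iff
        simp only [this]
        rw [Finset.sum_eq_single p₀ (fun p _ hp => by simp [hp]) (fun h => absurd (Finset.mem_univ _) h)]
        rw [Finset.sum_eq_single p₀ (fun q _ hq => by simp [hq]) (fun h => absurd (Finset.mem_univ _) h)]
        simp
      · rw [if_neg hpq]
        have hsplit : ∀ p q : Fin 6, (if (p = p₀ ∧ q = q₀) ∨ (p = q₀ ∧ q = p₀) then polar (W p) (W q) else 0)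
            = (if (p = p₀ ∧ q = q₀) then polar (W p) (W q) else 0) + (if (p = q₀ ∧ q = p₀) then polar (W p) (W q) else 0) := by
          intro p q
          by_cases h1 : p = p₀ ∧ q = q₀
          · have h2 : ¬ (p = q₀ ∧ q = p₀) := fun h2 => hpq (h1.1.symm.trans h2.1)
            rw [if_pos (Or.inl h1), if_pos h1, if_neg h2, add_zero]
          · by_cases h2 : p = q₀ ∧ q = p₀
            · rw [if_pos (Or.inr h2), if_neg h1, if_pos h2, zero_add]
            · rw [if_neg (not_or.mpr ⟨h1, h2⟩), if_neg h1, if_neg h2, add_zero]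
        simp only [hsplit, Finset.sum_add_distrib]
        have hA : ∑ p : Fin 6, ∑ q : Fin 6, (if (p = p₀ ∧ q = q₀) then polar (W p) (W q) else 0) = polar (W p₀) (W q₀) := by
          rw [Finset.sum_eq_single p₀ (fun p _ hp => by simp [hp]) (fun h => absurd (Finset.mem_univ _) h)]
          rw [Finset.sum_eq_single q₀ (fun q _ hq => by simp [hq]) (fun h => absurd (Finset.mem_univ _) h)]
          simp
        have hB : ∑ p : Fin 6, ∑ q : Fin 6, (if (p = q₀ ∧ q = p₀) then polar (W p) (W q) else 0) = polar (W p₀) (W q₀) := by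
          rw [Finset.sum_eq_single q₀ (fun p _ hp => by simp [hp]) (fun h => absurd (Finset.mem_univ _) h)]
          rw [Finset.sum_eq_single p₀ (fun q _ hq => by simp [hq]) (fun h => absurd (Finset.mem_univ _) h)]
          simp [polar_comm]
        rw [hA, hB]; ring
    have h0 : (P (δ0 p₀ + δ0 q₀)).coeff d₀ = 0 := by rw [hzero, coeff_zero]
    rw [hval] at h0
    split_ifs at h0 with hpq
    · exact hpq₀ h0
    · exact hpq₀ (by linarith)
  -- (d) the count: 21 distinct zeros would be too many
  have hslots : (∑ w ∈ F, if P w = 0 then 0 else (P w).natDegree + 1) ≤ 20 + 1 := by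
    have h1 := confluentDet_slots_le e P hdegP
    have h2 := (card_pairSums_five e).1
    rw [hF]
    omega
  set Z : Finset ℝ := (Finset.range 21).image (fun i : ℕ => (i : ℝ)) with hZ
  have hZcard : Z.card = 21 := by
    rw [hZ, Finset.card_image_of_injective _ Nat.cast_injective, Finset.card_range]
  have hle := extSum_card_zeros_le 20 F P hact hslots Z (fun z _ => hrep z)
  omega

end Summit.ValiantsHypothesis.ValiantsHypothesis.Theorems.LacunarySymmetroidMatrixDescartes.WallBubbling
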